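import Summits.MatrixMultiplication.OmegaCensus.DominoShiftedForm
import HarnessLib

/-!
# The shifts of a domino cube law triple are independent modulo 2 (the `ℤ₂`-quotient obstruction)

ω-census `pub-omega`, family (b3), seat pub-omega ENG2 gen 8.  Framing: lottery ticket; floor = certified bounds/negative
ranges.  VALUE: the kernel form of the first (coarsest) certificate of ENG2's quotient sieve (`qsieve`, DERIVATION-qsieve.md Q7)
and of ENG1's remark RADONG §5a′; NOT progress on ω.

In the shifted reduced form of `DominoShiftedForm.lean` — `X + Y`, `β + (Y − X)`, `γ + (X − Y)` direct, pairwise disjoint, with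
union `A ∖ {x₀}` — the shifts `β, γ` are never both in the kernel of a surjection `φ : A →+ ZMod 2`: pushing the partition forward
(`radon_identity_shifted`) with `φ β = φ γ = 0` gives `3·S(t) + [φ x₀ = t] = |φ⁻¹(t)|` for both `t`, and the two fibres of `φ` have
the same size, so `|φ⁻¹(t)|` would be `≡ 1` and `≡ 0 (mod 3)` at once.  Consequently, when `A/2A ≅ ℤ₂²` the classes of `β, γ` form a
basis of `A/2A`, and when the 2-rank of `A` is at least `3` no such data exist at all (a hyperplane of `A/2A` contains both classes).
-/

namespace Summit.MatrixMultiplication.OmegaCensus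

open Finset

variable {A : Type*} [AddCommGroup A] [DecidableEq A] [Fintype A]

/-- The two fibres of a surjective homomorphism onto `ZMod 2` have the same size. [folklore] -/
theorem card_fibre_zmod_two_eq (φ : A →+ ZMod 2) (hφ : Function.Surjective φ) (t : ZMod 2) :
    (univ.filter fun a : A => φ a = t).card = (univ.filter fun a : A => φ a = t + 1).card := by
  obtain ⟨a₁, ha₁⟩ := hφ 1
  have himg : (univ.filter fun a : A => φ a = t).image (fun a => a + a₁) = univ.filter fun a : A => φ a = t + 1 := by
    ext b
    simp only [mem_image, mem_filter, mem_univ, true_and]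
    constructor
    · rintro ⟨a, ha, rfl⟩
      rw [map_add, ha, ha₁]
    · intro hb
      refine ⟨b - a₁, ?_, sub_add_cancel b a₁⟩
      rw [map_sub, hb, ha₁, add_sub_cancel_right]
  rw [← himg, card_image_of_injective _ (add_left_injective a₁)]

/-- **The shifts are not both even.**  For data as produced by `domino_shifted_form_of_law` (sumset `X + Y` direct; `X + Y`,
`β + (Y − X)`, `γ + (X − Y)` pairwise disjoint with union `A ∖ {x₀}`) and a surjective `φ : A →+ ZMod 2`, the images
`φ β`, `φ γ` are not both `0`. [folklore] -/
theorem shifts_not_both_even (φ : A →+ ZMod 2) (hφ : Function.Surjective φ) {X Y : Finset A} {β γ x₀ : A}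
    (hinj : Set.InjOn (fun p : A × A => p.1 + p.2) ↑(X ×ˢ Y))
    (hPQ : Disjoint ((X ×ˢ Y).image fun p : A × A => p.1 + p.2)
      (((Y ×ˢ X).image fun p : A × A => p.1 - p.2).image fun z => z + β))
    (hPR : Disjoint ((X ×ˢ Y).image fun p : A × A => p.1 + p.2)
      (((X ×ˢ Y).image fun p : A × A => p.1 - p.2).image fun z => z + γ))
    (hQR : Disjoint (((Y ×ˢ X).image fun p : A × A => p.1 - p.2).image fun z => z + β)
      (((X ×ˢ Y).image fun p : A × A => p.1 - p.2).image fun z => z + γ))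
    (hcover : ((X ×ˢ Y).image fun p : A × A => p.1 + p.2) ∪
      (((Y ×ˢ X).image fun p : A × A => p.1 - p.2).image fun z => z + β) ∪
      (((X ×ˢ Y).image fun p : A × A => p.1 - p.2).image fun z => z + γ) = univ.erase x₀) :
    φ β ≠ 0 ∨ φ γ ≠ 0 := by
  by_contra h
  push Not at h
  obtain ⟨hb, hg⟩ := h
  have hsub : ∀ a b : ZMod 2, a - b = b - a := by decide
  have hadd : ∀ a b : ZMod 2, a + b = a - b := by decide
  have hne : ∀ a : ZMod 2, a ≠ a + 1 := by decide
  -- the pushed-forward identity with both shifts in the kernel: 3·S(t) + [φ x₀ = t] = |φ⁻¹(t)|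
  have key : ∀ t : ZMod 2, 3 * (∑ u : ZMod 2, (X.filter fun a => φ a = t - u).card * (Y.filter fun a => φ a = u).card) +
      (if φ x₀ = t then 1 else 0) = (univ.filter fun a : A => φ a = t).card := by
    intro t
    have h0 := radon_identity_shifted φ hinj hPQ hPR hQR hcover t
    have e1 : ∀ u : ZMod 2, (X.filter fun a => φ a = u - (t - φ β)) = X.filter fun a => φ a = t - u := by
      intro u; simp only [hb, sub_zero, hsub u t]
    have e2 : ∀ u : ZMod 2, (X.filter fun a => φ a = (t - φ γ) + u) = X.filter fun a => φ a = t - u := by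
      intro u; simp only [hg, sub_zero, hadd t u]
    simp only [e1, e2] at h0
    rw [← h0, mul_sum]
    congr 1
    exact sum_congr rfl fun u _ => by ring
  have k0 := key (φ x₀)
  have k1 := key (φ x₀ + 1)
  rw [if_pos rfl] at k0
  rw [if_neg (hne (φ x₀)), ← card_fibre_zmod_two_eq φ hφ (φ x₀)] at k1
  omega

end Summit.MatrixMultiplication.OmegaCensus
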